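/-
Copyright (c) 2026 the pub-hodgecm-mathlib formalisation cell (harness21).  Prover seat hodgecm-mathlib-K2E1-p16 (g3), Track B ∕ K2-LIT, h413 = `stmt-HodgeConjecture-24833`,
R90-TF section S8 «ContSpec-n½», socket B MID :358 ∕ (V) OF RECORD, deal S8-R210 (2): THE POLE-LEDGER COLUMN OF (V) IN ONE HEAD — the two ledger letters `hbddPK`, `hbdd32` of ★ p864046
about the NAMED twisted witness family `midWitnessEc·Θ ∕ midWitnessP`, from ★ exports and THREE remaining analytic letters about the UNTWISTED named family (`hE6`, `hMSP′`, `hMS32`);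
the letters `hEcinv` (★ p864271) and `hSM`, `hSM32` (★ `exists_chi_convData_level_cm_three` ∘ ★ p863948) are PAID here.
-/
import Summits.HodgeConjecture.HodgeConjecture.Theorems.R90S8MidWitnessExportsU3Defs                    -- ★ p864008 (K2E1-p15): `midWitnessEc ∕ midWitnessP`, `midWitnessExports_spec`
import Summits.HodgeConjecture.HodgeConjecture.Theorems.K2E1ChiEisensteinLeftInvarianceOffPolesCMThree    -- ★ p864271 (this seat): `hEcinv_of_codiscrete`, `isPreconnected_compl_of_codiscrete`
import Summits.HodgeConjecture.HodgeConjecture.Theorems.K2E1ChiEisensteinJointBoundOfL2FamilyCMThree      -- ★ p864057 (this seat): `hbddPK_of_L2Family_letters_cm_three`, `hbdd32_of_letters_cm_three` (brings ★ p863948 `integral_mul_continued_eq_of_eigen_cm_three`)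
import Summits.HodgeConjecture.HodgeConjecture.Theorems.K2E1ChiConvDataLevelCMThree                      -- ★ (K2E1 row-1 lineage): `exists_chi_convData_level_cm_three` (test functions WITH eigenvalues at level `(K′, ω)`)
import HarnessLib

/-!
# The pole-ledger letters of (V) at the NAMED witness family, from ★ exports (`K2E1ChiEisensteinLedgerLettersOfExportsCMThree`)

Track B ∕ K2-LIT, crux h413 = `stmt-HodgeConjecture-24833`, route of record `HCCMUnconditional`; cell `hodgecm-mathlib`, R90-TF programme, section S8 «ContSpec-n½», socket B MID :358
∕ (V).  THEOREMS ONLY (no `def`, no `instance`, no `notation`, no named-fact hypothesis, no `sorry`; default heartbeats); lane `--supports stmt-HodgeConjecture-24833 --as helper`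
(count-neutral).  CLOSES NO SOCKET.

★ p864046 `resGMidBlock_ne_bot_of_ledger_letters` ∕ ★ p864230 `resGMidBlock_ne_bot_of_record_v3` see the pole ledger only through TWO letters about the NAMED twisted family
`Ẽ := midWitnessEc·Θ` off `P := midWitnessP`: `hbddPK` (joint boundedness near every candidate pole `z₀ ∈ P`, `1 < Re z₀`, `z₀ ≠ 3∕2`, uniformly on compacts) and `hbdd32` (the simple-pole
bound at `3∕2`).  ★ p864057 pays them from SIX letters; this file discharges three of the six from ★ exports and re-prices the twisted letters in the UNTWISTED currency (`‖Θ‖ = 1`):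
* §1 `hEcinv_midWitness` — left-`G(F)`-invariance of the untwisted `midWitnessEc z` at every `z ∉ midWitnessP` (★ p864271 `hEcinv_of_codiscrete` on spec clauses 5, 8, 10; `V(χ, K′, ω) =
  V(χ, 1; K′, ω)` ★ `chiSectionSpacePair_one`, ★ `isAutomorphic_one`).
* §2 `hSM_midWitness` — THE SMOOTHING LETTER at EVERY `z₀ ∈ ℂ`: a real `h ∈ C_c(G(𝔸))` and an entire `s` with `s z₀ ≠ 0` and `∫ h(y)·E z (g·y) dν_G = s z·E z g` for all `z ∉ P`, `g` — the
  (χ,τ) ball data WITH EIGENVALUES ★ `exists_chi_convData_level_cm_three` (ball `n + 2 > ‖z₀‖`, the cover clause gives `i` with `ŝ_i z₀ ≠ 0`, `h := Re ∘ H_i` is `H_i` itself since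
  `conj H_i = H_i`, the action clause is ★ p863948's `hact`), continued from the tube to `ℂ ∖ P` by ★ `integral_mul_continued_eq_of_eigen_cm_three` on `D := (midWitnessP)ᶜ` — open (clause 7),
  PRECONNECTED (★ p864271 §1), containing the half-plane `{2 < Re}` (clause 9), with clauses 5, 12, 14, 15 as its analytic data.
* §3 HEAD `ledgerLetters_of_exports` — `hbddPK ∧ hbdd32` for `midWitnessEc·Θ` VERBATIM as ★ p864046 binds them, from the spec's binders and the THREE remaining letters about the untwisted
  family: `hE6` ((E6) `L²` representatives of `Λ^T E(z)` off `P`, every `T ≥ 1`), `hMSP′` ((MS-P′): an eventual `L²`-bound of such representatives near every candidate pole off `3∕2` with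
  `1 < Re`), `hMS32` ((MS-3∕2) in `eLpNorm` form) — ★ p864057's two heads at `(E, P) := (midWitnessEc, midWitnessP)`, then `‖E z g·Θ g‖ = ‖E z g‖` (★ `AutomorphicCharacter.norm_coe`).
VISIBLE → PAYER: `hE6` ⇐ (E6) of ★ p863930 transported to the named family (needs removability at the foreign candidate poles, i.e. (MS-P′)); `hMSP′` ⇐ on the axis ★ p864145 modulo the
ℓ-CT scalar letters, off the axis the pole exclusion `Im z₀ ≠ 0` (not ★ yet); `hMS32` ⇐ ★ p864109 ∘ ★ p863403 modulo the ℓ-CT scalars.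
HONEST LABEL: HC_CM is proved only modulo the 7 printed citations (2 remaining named inputs: hLiu418 = `stmt-HodgeConjecture-24832`, h413 = `stmt-HodgeConjecture-24833`) until
rung 0 closes; helpers close no socket; (V) :358 stays `sorry` in B until every visible row is ★ and instantiated; REL ≠ ★ ≠ WRITTEN ≠ BUILT; count-neutral.

## References
* [MoeglinWaldspurger1995] C. Mœglin, J.-L. Waldspurger, *Spectral Decomposition and Eisenstein Series* (1995), II.1.5, IV.1.8–IV.1.11, IV.3.12.
* [BernsteinLapid2019] J. Bernstein, E. Lapid, *On the meromorphic continuation of Eisenstein series*, J. Amer. Math. Soc. 37 (2024), Thm 2.3, §4 Claim 1 (test functions with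
  non-vanishing eigenvalue at a given parameter).
* [Conway1978] J. B. Conway, *Functions of One Complex Variable I*, 2nd ed. (1978), IV §3 Thm 3.7.
-/

set_option autoImplicit false
set_option linter.dupNamespace false  -- the mandated `Summit.HodgeConjecture.HodgeConjecture.…` prefix repeats the summit's segment

noncomputable section

open MeasureTheory Measure Filter Topology Set NumberField IsDedekindDomain
open scoped NNReal ENNReal MatrixGroups ComplexConjugate
open Literature.MeasureTheory.Group Literature.NumberTheory Literature.NumberTheory.Automorphic Literature.NumberTheory.Automorphic.UnitaryGroup AdelicGroupData
open Literature.NumberTheory.Automorphic.Arthur2013.Leaves.TECR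
open Literature.NumberTheory.GaloisRepresentations (HeckeCharacter)
open Summit.HodgeConjecture.HodgeConjecture.Cruxes.H413.K2E1BorelEisensteinU
open Summit.HodgeConjecture.HodgeConjecture.Cruxes.H413.K2E1BLBorelSpacesU2Defs
open Summit.HodgeConjecture.HodgeConjecture.Cruxes.H413.K2E1BLBorelOperatorsU2Defs
open Summit.HodgeConjecture.HodgeConjecture.Cruxes.H413.K2E1CharacterEisensteinU2Defs
open Summit.HodgeConjecture.HodgeConjecture.Cruxes.H413.K2E1ChiSectionSpaceU2Defs
open Summit.HodgeConjecture.HodgeConjecture.Cruxes.H413.K2E1CharacterEisensteinU3PairDefs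
open Summit.HodgeConjecture.HodgeConjecture.Cruxes.H413.K2E1ChiSectionSpaceU3PairDefs
open Summit.HodgeConjecture.HodgeConjecture.Cruxes.H413.K2E1ChiEisensteinMeromorphicExportsM1CMThree (isAutomorphic_one)
open Summit.HodgeConjecture.HodgeConjecture.Cruxes.H413.K2E1ChiEisensteinLeftInvarianceOffPolesCMThree (hEcinv_of_codiscrete isPreconnected_compl_of_codiscrete)
open Summit.HodgeConjecture.HodgeConjecture.Cruxes.H413.K2E1EventualL2BoundPointwiseAtLevelCMThree (integral_mul_continued_eq_of_eigen_cm_three)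
open Summit.HodgeConjecture.HodgeConjecture.Cruxes.H413.K2E1ChiEisensteinJointBoundOfL2FamilyCMThree (hbddPK_of_L2Family_letters_cm_three hbdd32_of_letters_cm_three)
open Summit.HodgeConjecture.HodgeConjecture.Cruxes.H413.K2E1ChiConvDataLevelCMThree (exists_chi_convData_level_cm_three)
open Summit.HodgeConjecture.HodgeConjecture.R90.S8

namespace Summit.HodgeConjecture.HodgeConjecture.Cruxes.H413.K2E1ChiEisensteinLedgerLettersOfExportsCMThree

variable (L : Type) [Field L] [NumberField L] [IsCMField L]
  [MeasurableSpace (quasiSplit (↥(maximalRealSubfield L)) L (IsCMField.complexConj L) 3).Adelic] [BorelSpace (quasiSplit (↥(maximalRealSubfield L)) L (IsCMField.complexConj L) 3).Adelic]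
  [MeasurableSpace (arch (↥(maximalRealSubfield L)) L (IsCMField.complexConj L) 3 ((StdForm.antidiagonal 3).over L))] [BorelSpace (arch (↥(maximalRealSubfield L)) L (IsCMField.complexConj L) 3 ((StdForm.antidiagonal 3).over L))]
  [MeasurableSpace (finAdelic (↥(maximalRealSubfield L)) L (IsCMField.complexConj L) 3 ((StdForm.antidiagonal 3).over L))] [BorelSpace (finAdelic (↥(maximalRealSubfield L)) L (IsCMField.complexConj L) 3 ((StdForm.antidiagonal 3).over L))]

/-! ## §1 `hEcinv` for the untwisted named family -/

/-- **`hEcinv` AT THE NAMED UNTWISTED FAMILY**: `midWitnessEc z (γ·x) = midWitnessEc z x` for every `z ∉ midWitnessP`, `γ ∈ G(F)`, `x` — ★ p864271 `hEcinv_of_codiscrete` on the spec's tube identity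
(clause 5), co-discreteness (clause 8) and analyticity off `P` (clause 10); `φ ∈ V(χ, K′, ω) = V(χ, 1; K′, ω)` (★ `chiSectionSpacePair_one`) with `1` automorphic. [cite: MoeglinWaldspurger1995, II.1.5, IV.1.11] -/
theorem hEcinv_midWitness
    (μ : Measure (quasiSplit (↥(maximalRealSubfield L)) L (IsCMField.complexConj L) 3).automorphicQuotient) [(quasiSplit (↥(maximalRealSubfield L)) L (IsCMField.complexConj L) 3).IsAutomorphicMeasure μ]
    (νG : Measure (quasiSplit (↥(maximalRealSubfield L)) L (IsCMField.complexConj L) 3).Adelic) [νG.IsHaarMeasure] [νG.IsInvInvariant] [SFinite νG]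
    (ν : Measure ↥(adelicUnipotent (↥(maximalRealSubfield L)) L (IsCMField.complexConj L) 3)) [ν.IsHaarMeasure] [ν.IsMulRightInvariant] [ν.IsInvInvariant]
    {𝓕 : Set ↥(adelicUnipotent (↥(maximalRealSubfield L)) L (IsCMField.complexConj L) 3)}
    (h𝓕N : IsFundamentalDomain ↥(rationalUnipotent (↥(maximalRealSubfield L)) L (IsCMField.complexConj L) 3) 𝓕 ν) (h𝓕c : IsCompact (closure 𝓕)) (h𝓕₀ : ν 𝓕 ≠ 0)
    {β : (quasiSplit (↥(maximalRealSubfield L)) L (IsCMField.complexConj L) 3).Adelic → ℝ≥0∞}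
    (hβ : IsCoveringWeight ↥((arithmeticBorel (↥(maximalRealSubfield L)) L (IsCMField.complexConj L) 3).map (quasiSplit (↥(maximalRealSubfield L)) L (IsCMField.complexConj L) 3).arithmeticSubgroup.subtype) β)
    {μZ : Measure (borelQuotient (↥(maximalRealSubfield L)) L (IsCMField.complexConj L) 3)} [SFinite μZ]
    (hμZ : ∀ f : borelQuotient (↥(maximalRealSubfield L)) L (IsCMField.complexConj L) 3 → ℝ≥0∞, Measurable f → ∫⁻ z, f z ∂μZ = ∫⁻ g, β g * f (toBorelQuotient (↥(maximalRealSubfield L)) L (IsCMField.complexConj L) 3 g) ∂νG)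
    -- the M1 family: `φ ∈ V(χ, K, 1)` continuous bounded with `φ ∘ ι_∞ = φ(1)`, and a basis of `V(χʷ, K, 1)` by continuous bounded functions
    {χ : HeckeCharacter L} {K' : Subgroup (quasiSplit (↥(maximalRealSubfield L)) L (IsCMField.complexConj L) 3).Adelic} {ω : ↥K' → ℂ} {φ : (quasiSplit (↥(maximalRealSubfield L)) L (IsCMField.complexConj L) 3).Adelic → ℂ} (hφV : φ ∈ chiSectionSpace χ K' ω) (hφc : Continuous φ) {Mφ : ℝ} (hφM : ∀ x, ‖φ x‖ ≤ Mφ)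
    -- the LEVEL: `K′ ≤ K`, `ι(K_∞) ⊆ K′`, an open compact `U₀` with `ι_f(U₀ ∩ G_f) ⊆ K′` on which `ω = 1`, continuity of the sections; auxiliary Haar measures on `G_∞` (two-sided) and `G(𝔸_f)`
    (hK' : K' ≤ ((standardMaximalCompactGL 3 L).comap (adelicVal (↥(maximalRealSubfield L)) L (IsCMField.complexConj L) 3 ((StdForm.antidiagonal 3).over L)) : Subgroup (quasiSplit (↥(maximalRealSubfield L)) L (IsCMField.complexConj L) 3).Adelic))
    (hKinf : ∀ k : arch (↥(maximalRealSubfield L)) L (IsCMField.complexConj L) 3 ((StdForm.antidiagonal 3).over L), adelicVal (↥(maximalRealSubfield L)) L (IsCMField.complexConj L) 3 ((StdForm.antidiagonal 3).over L) (archToAdelic (↥(maximalRealSubfield L)) L (IsCMField.complexConj L) 3 _ k) ∈ standardMaximalCompactGL 3 L →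
      archToAdelic (↥(maximalRealSubfield L)) L (IsCMField.complexConj L) 3 _ k ∈ K')
    (U₀ : Subgroup (GL (Fin 3) (FiniteAdeleRing (𝓞 L) L))) (hU₀o : IsOpen (U₀ : Set (GL (Fin 3) (FiniteAdeleRing (𝓞 L) L)))) (hU₀c : IsCompact (U₀ : Set (GL (Fin 3) (FiniteAdeleRing (𝓞 L) L))))
    (hU : ∀ b : finAdelic (↥(maximalRealSubfield L)) L (IsCMField.complexConj L) 3 ((StdForm.antidiagonal 3).over L), (b : GL (Fin 3) (FiniteAdeleRing (𝓞 L) L)) ∈ U₀ →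
      ∃ hb : finAdelicToAdelic (↥(maximalRealSubfield L)) L (IsCMField.complexConj L) 3 ((StdForm.antidiagonal 3).over L) b ∈ K', ω ⟨_, hb⟩ = 1)
    (hVc : ∀ φ ∈ chiSectionSpace χ K' ω, Continuous φ)
    (μa : Measure (arch (↥(maximalRealSubfield L)) L (IsCMField.complexConj L) 3 ((StdForm.antidiagonal 3).over L))) [μa.IsHaarMeasure] [μa.IsMulRightInvariant]
    (μf : Measure (finAdelic (↥(maximalRealSubfield L)) L (IsCMField.complexConj L) 3 ((StdForm.antidiagonal 3).over L))) [μf.IsHaarMeasure]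
    {ι' : Type} [Fintype ι'] [DecidableEq ι'] (bV : Module.Basis ι' ℂ ↥(chiSectionSpace (reflectChar (IsCMField.complexConj L) χ) K' ω))
    (hbc : ∀ j, Continuous ((bV j : ↥(chiSectionSpace (reflectChar (IsCMField.complexConj L) χ) K' ω)) : (quasiSplit (↥(maximalRealSubfield L)) L (IsCMField.complexConj L) 3).Adelic → ℂ)) {Mb : ℝ} (hbM : ∀ j x, ‖((bV j : ↥(chiSectionSpace (reflectChar (IsCMField.complexConj L) χ) K' ω)) : (quasiSplit (↥(maximalRealSubfield L)) L (IsCMField.complexConj L) 3).Adelic → ℂ) x‖ ≤ Mb)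
    (h2 : Module.finrank (↥(maximalRealSubfield L)) L = 2) (hc : IsCMField.complexConj L ≠ 1) (hJ : ((StdForm.antidiagonal 3).over L).det ≠ 0)
    (ψ : ↥(TorusDict.torus (IsCMField.complexConj L)) →ₜ* ℂˣ) (hψ : TorusDict.IsAutomorphic (IsCMField.complexConj L) ψ) :
    ∀ z : ℂ, z ∉ midWitnessP L μ νG ν h𝓕N h𝓕c h𝓕₀ hβ hμZ hφV hφc hφM hK' hKinf U₀ hU₀o hU₀c hU hVc μa μf bV hbc hbM h2 hc hJ ψ hψ → ∀ (γ : (quasiSplit (↥(maximalRealSubfield L)) L (IsCMField.complexConj L) 3).arithmeticSubgroup) (x : (quasiSplit (↥(maximalRealSubfield L)) L (IsCMField.complexConj L) 3).Adelic), midWitnessEc L μ νG ν h𝓕N h𝓕c h𝓕₀ hβ hμZ hφV hφc hφM hK' hKinf U₀ hU₀o hU₀c hU hVc μa μf bV hbc hbM h2 hc hJ ψ hψ z ((γ : (quasiSplit (↥(maximalRealSubfield L)) L (IsCMField.complexConj L) 3).Adelic) * x) = midWitnessEc L μ νG ν h𝓕N h𝓕c h𝓕₀ hβ hμZ hφV hφc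 hφM hK' hKinf U₀ hU₀o hU₀c hU hVc μa μf bV hbc hbM h2 hc hJ ψ hψ z x := by
  obtain ⟨-, -, -, -, htube, -, -, hPcd, -, hEan, -⟩ := midWitnessExports_spec L μ νG ν h𝓕N h𝓕c h𝓕₀ hβ hμZ hφV hφc hφM hK' hKinf U₀ hU₀o hU₀c hU hVc μa μf bV hbc hbM h2 hc hJ ψ hψ
  have hφV' := hφV
  rw [← chiSectionSpacePair_one] at hφV'
  exact hEcinv_of_codiscrete L (isChiSectionPair_of_mem hφV') (isAutomorphic_one (IsCMField.complexConj L)) hPcd hEan htube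

/-! ## §2 The smoothing letter at every parameter, from the (χ,τ) ball data with eigenvalues -/

omit [MeasurableSpace (arch (↥(maximalRealSubfield L)) L (IsCMField.complexConj L) 3 ((StdForm.antidiagonal 3).over L))] [BorelSpace (arch (↥(maximalRealSubfield L)) L (IsCMField.complexConj L) 3 ((StdForm.antidiagonal 3).over L))]
  [MeasurableSpace (finAdelic (↥(maximalRealSubfield L)) L (IsCMField.complexConj L) 3 ((StdForm.antidiagonal 3).over L))] [BorelSpace (finAdelic (↥(maximalRealSubfield L)) L (IsCMField.complexConj L) 3 ((StdForm.antidiagonal 3).over L))] in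
/-- **FROM ONE EIGEN TEST FUNCTION TO THE SMOOTHING LETTER** (the generic step of §2): a complex test function `H ∈ C_c(G(𝔸))` with `conj H = H` acting on the flat sections of
`V(χ, K′, ω)` by the entire scalar `ŝ` — `∫ H(y)·φ_z(x·y) dν_G = ŝ(z)·φ_z(x)` for ALL `z`, `φ ∈ V` — gives, for continuation data `(Ec, P)` of a continuous bounded `φ ∈ V` (`P` closed,
co-discrete, inside `{Re ≤ 2}`; `Ec · g` holomorphic on `Pᶜ`, `Ec z` continuous and locally compact-uniformly bounded off `P`, `Ec z = E(φ_z)` on `2 < Re z`), the REAL test function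
`h := Re ∘ H` with `∫ h(y)·Ec z (g·y) dν_G = ŝ(z)·Ec z g` for all `z ∉ P` (★ p863948 on the preconnected `Pᶜ`, ★ p864271 §1). [cite: BernsteinLapid2019, §4 Claim 1] [cite: MoeglinWaldspurger1995, IV.1.11] -/
theorem smoothing_identity_off_poles_of_eigen
    (νG : Measure (quasiSplit (↥(maximalRealSubfield L)) L (IsCMField.complexConj L) 3).Adelic) [νG.IsHaarMeasure]
    {χ : HeckeCharacter L} {K' : Subgroup (quasiSplit (↥(maximalRealSubfield L)) L (IsCMField.complexConj L) 3).Adelic} {ω : ↥K' → ℂ}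
    {φ : (quasiSplit (↥(maximalRealSubfield L)) L (IsCMField.complexConj L) 3).Adelic → ℂ} (hφV : φ ∈ chiSectionSpace χ K' ω) (hφc : Continuous φ) {Mφ : ℝ} (hφM : ∀ x, ‖φ x‖ ≤ Mφ)
    {H : (quasiSplit (↥(maximalRealSubfield L)) L (IsCMField.complexConj L) 3).Adelic → ℂ} (hHc : Continuous H) (hHs : HasCompactSupport H) (hHconj : ∀ g, conj (H g) = H g)
    {ŝ : ℂ → ℂ} (hŝ : Differentiable ℂ ŝ)
    (hact : ∀ z : ℂ, ∀ φ' ∈ chiSectionSpace χ K' ω, ∀ x : (quasiSplit (↥(maximalRealSubfield L)) L (IsCMField.complexConj L) 3).Adelic, (∫ y, H y * flatSectionU φ' z (x * y) ∂νG) = ŝ z * flatSectionU φ' z x)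
    (Ec : ℂ → (quasiSplit (↥(maximalRealSubfield L)) L (IsCMField.complexConj L) 3).Adelic → ℂ) {P : Set ℂ} (hPc : IsClosed P) (hPcd : ∀ z₀ : ℂ, ∀ᶠ s in 𝓝[≠] z₀, s ∉ P) (hPre : ∀ z ∈ P, z.re ≤ 2)
    (hE2 : ∀ z : ℂ, 2 < z.re → Ec z = eisensteinSeriesU (flatSectionU φ z))
    (hEd : ∀ g, DifferentiableOn ℂ (fun z => Ec z g) Pᶜ) (hEc : ∀ z : ℂ, z ∉ P → Continuous (Ec z))
    (hEbd : ∀ z₁ : ℂ, z₁ ∉ P → ∀ K : Set (quasiSplit (↥(maximalRealSubfield L)) L (IsCMField.complexConj L) 3).Adelic, IsCompact K → ∃ V ∈ 𝓝 z₁, ∃ M : ℝ, ∀ z ∈ V, ∀ g ∈ K, ‖Ec z g‖ ≤ M) :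
    ∀ z : ℂ, z ∉ P → ∀ g : (quasiSplit (↥(maximalRealSubfield L)) L (IsCMField.complexConj L) 3).Adelic, ∫ y, (((fun y => (H y).re) y : ℝ) : ℂ) * Ec z (g * y) ∂νG = ŝ z * Ec z g := by
  -- `h := Re ∘ H` is `H` itself
  have hre : ∀ y, ((((fun y => (H y).re) y : ℝ)) : ℂ) = H y := fun y => Complex.conj_eq_iff_re.1 (hHconj y)
  have hhc : Continuous fun y => (H y).re := Complex.continuous_re.comp hHc
  have hhs : HasCompactSupport fun y => (H y).re := hHs.comp_left Complex.zero_re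
  -- the seed: the half-plane `{2 < Re}` lies in `Pᶜ`, around the real point `3`
  have hσD : ∀ᶠ z in 𝓝 (((3 : ℝ) : ℂ)), z ∈ Pᶜ :=
    Filter.eventually_of_mem ((isOpen_lt continuous_const Complex.continuous_re).mem_nhds (show (2 : ℝ) < (((3 : ℝ) : ℂ)).re by norm_num))
      fun z hz hzP => absurd (hPre z hzP) (not_le.2 hz)
  have key := integral_mul_continued_eq_of_eigen_cm_three L νG hhc hhs hφc hφM Ec hPc.isOpen_compl (isPreconnected_compl_of_codiscrete hPcd)
    (σ₀ := 3) (by norm_num) hσD hEd (fun z hz => hEc z hz) (fun z₁ hz₁ K hK => hEbd z₁ hz₁ K hK) (fun z _ hz => hE2 z hz) (hŝ.differentiableOn)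
    (fun z _ _ x => by simp_rw [hre]; exact hact z φ hφV x)
  exact fun z hz g => key z hz g

/-- **THE SMOOTHING LETTER AT THE NAMED UNTWISTED FAMILY, AT EVERY `z₀ ∈ ℂ`**: `∃ h : G(𝔸) → ℝ, ∃ s, h ∈ C_c, s continuous at z₀, s z₀ ≠ 0, ∫ h(y)·midWitnessEc z (g·y) dν_G = s z·midWitnessEc z g`
for all `z ∉ midWitnessP`, `g` — the (χ,τ) ball data with eigenvalues (★ `exists_chi_convData_level_cm_three` at the ball `n := ⌈‖z₀‖⌉₊`, whose cover clause gives a member `i` with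
`ŝ_i z₀ ≠ 0`) through `smoothing_identity_off_poles_of_eigen` on the spec's clauses 5, 7, 8, 9, 12, 14, 15.  This is ★ p864057's letter `hSM` (at any `z₀`) and `hSM32` (at `z₀ = 3∕2`).
[cite: BernsteinLapid2019, §4 Claim 1] [cite: MoeglinWaldspurger1995, IV.1.11, IV.3.12] -/
theorem hSM_midWitness
    (μ : Measure (quasiSplit (↥(maximalRealSubfield L)) L (IsCMField.complexConj L) 3).automorphicQuotient) [(quasiSplit (↥(maximalRealSubfield L)) L (IsCMField.complexConj L) 3).IsAutomorphicMeasure μ]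
    (νG : Measure (quasiSplit (↥(maximalRealSubfield L)) L (IsCMField.complexConj L) 3).Adelic) [νG.IsHaarMeasure] [νG.IsInvInvariant] [SFinite νG]
    (ν : Measure ↥(adelicUnipotent (↥(maximalRealSubfield L)) L (IsCMField.complexConj L) 3)) [ν.IsHaarMeasure] [ν.IsMulRightInvariant] [ν.IsInvInvariant]
    {𝓕 : Set ↥(adelicUnipotent (↥(maximalRealSubfield L)) L (IsCMField.complexConj L) 3)}
    (h𝓕N : IsFundamentalDomain ↥(rationalUnipotent (↥(maximalRealSubfield L)) L (IsCMField.complexConj L) 3) 𝓕 ν) (h𝓕c : IsCompact (closure 𝓕)) (h𝓕₀ : ν 𝓕 ≠ 0)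
    {β : (quasiSplit (↥(maximalRealSubfield L)) L (IsCMField.complexConj L) 3).Adelic → ℝ≥0∞}
    (hβ : IsCoveringWeight ↥((arithmeticBorel (↥(maximalRealSubfield L)) L (IsCMField.complexConj L) 3).map (quasiSplit (↥(maximalRealSubfield L)) L (IsCMField.complexConj L) 3).arithmeticSubgroup.subtype) β)
    {μZ : Measure (borelQuotient (↥(maximalRealSubfield L)) L (IsCMField.complexConj L) 3)} [SFinite μZ]
    (hμZ : ∀ f : borelQuotient (↥(maximalRealSubfield L)) L (IsCMField.complexConj L) 3 → ℝ≥0∞, Measurable f → ∫⁻ z, f z ∂μZ = ∫⁻ g, β g * f (toBorelQuotient (↥(maximalRealSubfield L)) L (IsCMField.complexConj L) 3 g) ∂νG)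
    -- the M1 family: `φ ∈ V(χ, K, 1)` continuous bounded with `φ ∘ ι_∞ = φ(1)`, and a basis of `V(χʷ, K, 1)` by continuous bounded functions
    {χ : HeckeCharacter L} {K' : Subgroup (quasiSplit (↥(maximalRealSubfield L)) L (IsCMField.complexConj L) 3).Adelic} {ω : ↥K' → ℂ} {φ : (quasiSplit (↥(maximalRealSubfield L)) L (IsCMField.complexConj L) 3).Adelic → ℂ} (hφV : φ ∈ chiSectionSpace χ K' ω) (hφc : Continuous φ) {Mφ : ℝ} (hφM : ∀ x, ‖φ x‖ ≤ Mφ)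
    -- the LEVEL: `K′ ≤ K`, `ι(K_∞) ⊆ K′`, an open compact `U₀` with `ι_f(U₀ ∩ G_f) ⊆ K′` on which `ω = 1`, continuity of the sections; auxiliary Haar measures on `G_∞` (two-sided) and `G(𝔸_f)`
    (hK' : K' ≤ ((standardMaximalCompactGL 3 L).comap (adelicVal (↥(maximalRealSubfield L)) L (IsCMField.complexConj L) 3 ((StdForm.antidiagonal 3).over L)) : Subgroup (quasiSplit (↥(maximalRealSubfield L)) L (IsCMField.complexConj L) 3).Adelic))
    (hKinf : ∀ k : arch (↥(maximalRealSubfield L)) L (IsCMField.complexConj L) 3 ((StdForm.antidiagonal 3).over L), adelicVal (↥(maximalRealSubfield L)) L (IsCMField.complexConj L) 3 ((StdForm.antidiagonal 3).over L) (archToAdelic (↥(maximalRealSubfield L)) L (IsCMField.complexConj L) 3 _ k) ∈ standardMaximalCompactGL 3 L →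
      archToAdelic (↥(maximalRealSubfield L)) L (IsCMField.complexConj L) 3 _ k ∈ K')
    (U₀ : Subgroup (GL (Fin 3) (FiniteAdeleRing (𝓞 L) L))) (hU₀o : IsOpen (U₀ : Set (GL (Fin 3) (FiniteAdeleRing (𝓞 L) L)))) (hU₀c : IsCompact (U₀ : Set (GL (Fin 3) (FiniteAdeleRing (𝓞 L) L))))
    (hU : ∀ b : finAdelic (↥(maximalRealSubfield L)) L (IsCMField.complexConj L) 3 ((StdForm.antidiagonal 3).over L), (b : GL (Fin 3) (FiniteAdeleRing (𝓞 L) L)) ∈ U₀ →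
      ∃ hb : finAdelicToAdelic (↥(maximalRealSubfield L)) L (IsCMField.complexConj L) 3 ((StdForm.antidiagonal 3).over L) b ∈ K', ω ⟨_, hb⟩ = 1)
    (hVc : ∀ φ ∈ chiSectionSpace χ K' ω, Continuous φ)
    (μa : Measure (arch (↥(maximalRealSubfield L)) L (IsCMField.complexConj L) 3 ((StdForm.antidiagonal 3).over L))) [μa.IsHaarMeasure] [μa.IsMulRightInvariant]
    (μf : Measure (finAdelic (↥(maximalRealSubfield L)) L (IsCMField.complexConj L) 3 ((StdForm.antidiagonal 3).over L))) [μf.IsHaarMeasure]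
    {ι' : Type} [Fintype ι'] [DecidableEq ι'] (bV : Module.Basis ι' ℂ ↥(chiSectionSpace (reflectChar (IsCMField.complexConj L) χ) K' ω))
    (hbc : ∀ j, Continuous ((bV j : ↥(chiSectionSpace (reflectChar (IsCMField.complexConj L) χ) K' ω)) : (quasiSplit (↥(maximalRealSubfield L)) L (IsCMField.complexConj L) 3).Adelic → ℂ)) {Mb : ℝ} (hbM : ∀ j x, ‖((bV j : ↥(chiSectionSpace (reflectChar (IsCMField.complexConj L) χ) K' ω)) : (quasiSplit (↥(maximalRealSubfield L)) L (IsCMField.complexConj L) 3).Adelic → ℂ) x‖ ≤ Mb)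
    (h2 : Module.finrank (↥(maximalRealSubfield L)) L = 2) (hc : IsCMField.complexConj L ≠ 1) (hJ : ((StdForm.antidiagonal 3).over L).det ≠ 0)
    (ψ : ↥(TorusDict.torus (IsCMField.complexConj L)) →ₜ* ℂˣ) (hψ : TorusDict.IsAutomorphic (IsCMField.complexConj L) ψ) (z₀ : ℂ) :
    ∃ (h : (quasiSplit (↥(maximalRealSubfield L)) L (IsCMField.complexConj L) 3).Adelic → ℝ) (s : ℂ → ℂ),
      Continuous h ∧ HasCompactSupport h ∧ ContinuousAt s z₀ ∧ s z₀ ≠ 0 ∧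
        ∀ z : ℂ, z ∉ midWitnessP L μ νG ν h𝓕N h𝓕c h𝓕₀ hβ hμZ hφV hφc hφM hK' hKinf U₀ hU₀o hU₀c hU hVc μa μf bV hbc hbM h2 hc hJ ψ hψ → ∀ g : (quasiSplit (↥(maximalRealSubfield L)) L (IsCMField.complexConj L) 3).Adelic, ∫ y, ((h y : ℝ) : ℂ) * midWitnessEc L μ νG ν h𝓕N h𝓕c h𝓕₀ hβ hμZ hφV hφc hφM hK' hKinf U₀ hU₀o hU₀c hU hVc μa μf bV hbc hbM h2 hc hJ ψ hψ z (g * y) ∂νG = s z * midWitnessEc L μ νG ν h𝓕N h𝓕c h𝓕₀ hβ hμZ hφV hφc hφM hK' hKinf U₀ hU₀o hU₀c hU hVc μa μf bV hbc hbM h2 hc hJ ψ hψ z g := by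
  obtain ⟨-, -, -, -, htube, -, hPc, hPcd, hPre, -, -, hEd, -, hEc, hEbd, -⟩ := midWitnessExports_spec L μ νG ν h𝓕N h𝓕c h𝓕₀ hβ hμZ hφV hφc hφM hK' hKinf U₀ hU₀o hU₀c hU hVc μa μf bV hbc hbM h2 hc hJ ψ hψ
  obtain ⟨a, ha, I, hI, i₀, η, κ, T, ŝ, -, hH, hŝd, hact, hcover, -⟩ :=
    exists_chi_convData_level_cm_three L μ νG hβ hμZ μa μf hK' hKinf U₀ hU₀o hU₀c hU hVc ⌈‖z₀‖⌉₊
  have hz₀ : z₀ ∈ Metric.ball (0 : ℂ) ((⌈‖z₀‖⌉₊ : ℕ) + 2) := by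
    rw [Metric.mem_ball, dist_zero_right]
    have h1 : ‖z₀‖ ≤ (⌈‖z₀‖⌉₊ : ℝ) := Nat.le_ceil _
    linarith
  obtain ⟨i, hi⟩ := hcover z₀ hz₀
  obtain ⟨hHc, hHs, -, hHconj, -⟩ := hH i
  exact ⟨_, ŝ i, Complex.continuous_re.comp hHc, hHs.comp_left Complex.zero_re, (hŝd i).continuous.continuousAt, hi,
    smoothing_identity_off_poles_of_eigen L νG hφV hφc hφM hHc hHs hHconj (hŝd i) (hact i) (midWitnessEc L μ νG ν h𝓕N h𝓕c h𝓕₀ hβ hμZ hφV hφc hφM hK' hKinf U₀ hU₀o hU₀c hU hVc μa μf bV hbc hbM h2 hc hJ ψ hψ) hPc hPcd hPre htube hEd hEc hEbd⟩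

/-! ## §3 HEAD: the two ledger letters of ★ p864046 for the NAMED twisted family -/

/-- **THE POLE-LEDGER COLUMN OF (V) IN ONE HEAD**: for the witness data of ★ `midWitnessExports_spec` and the THREE remaining analytic letters about the UNTWISTED named family
`E := midWitnessEc` off `P := midWitnessP` — `hE6` (`L²` representatives of `Λ^T E(z)`, `z ∉ P`, every `T ≥ 1`), `hMSP′` (near every `z₀ ∈ P` with `1 < Re z₀`, `z₀ ≠ 3∕2`: representatives
with an eventual bound `‖Fam z‖ ≤ C` on a punctured neighbourhood), `hMS32` (`‖z − 3∕2‖·‖Λ^T E(z)‖₂ ≤ C` near `3∕2`) — the two binders `hbddPK`, `hbdd32` of ★ p864046 ∕ ★ p864230 for the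
TWISTED family `midWitnessEc·Θ` hold VERBATIM: ★ p864057's two heads at `(E, P)` with `hEcinv` (§1) and the smoothing letters (§2) discharged, then `‖E z g·Θ g‖ = ‖E z g‖`.
[cite: MoeglinWaldspurger1995, IV.1.11, IV.3.12] [cite: BernsteinLapid2019, Thm 2.3, §4] -/
theorem ledgerLetters_of_exports
    (μ : Measure (quasiSplit (↥(maximalRealSubfield L)) L (IsCMField.complexConj L) 3).automorphicQuotient) [(quasiSplit (↥(maximalRealSubfield L)) L (IsCMField.complexConj L) 3).IsAutomorphicMeasure μ]
    (νG : Measure (quasiSplit (↥(maximalRealSubfield L)) L (IsCMField.complexConj L) 3).Adelic) [νG.IsHaarMeasure] [νG.IsInvInvariant] [SFinite νG]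
    (ν : Measure ↥(adelicUnipotent (↥(maximalRealSubfield L)) L (IsCMField.complexConj L) 3)) [ν.IsHaarMeasure] [ν.IsMulRightInvariant] [ν.IsInvInvariant]
    {𝓕 : Set ↥(adelicUnipotent (↥(maximalRealSubfield L)) L (IsCMField.complexConj L) 3)}
    (h𝓕N : IsFundamentalDomain ↥(rationalUnipotent (↥(maximalRealSubfield L)) L (IsCMField.complexConj L) 3) 𝓕 ν) (h𝓕c : IsCompact (closure 𝓕)) (h𝓕₀ : ν 𝓕 ≠ 0)
    {β : (quasiSplit (↥(maximalRealSubfield L)) L (IsCMField.complexConj L) 3).Adelic → ℝ≥0∞}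
    (hβ : IsCoveringWeight ↥((arithmeticBorel (↥(maximalRealSubfield L)) L (IsCMField.complexConj L) 3).map (quasiSplit (↥(maximalRealSubfield L)) L (IsCMField.complexConj L) 3).arithmeticSubgroup.subtype) β)
    {μZ : Measure (borelQuotient (↥(maximalRealSubfield L)) L (IsCMField.complexConj L) 3)} [SFinite μZ]
    (hμZ : ∀ f : borelQuotient (↥(maximalRealSubfield L)) L (IsCMField.complexConj L) 3 → ℝ≥0∞, Measurable f → ∫⁻ z, f z ∂μZ = ∫⁻ g, β g * f (toBorelQuotient (↥(maximalRealSubfield L)) L (IsCMField.complexConj L) 3 g) ∂νG)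
    -- the M1 family: `φ ∈ V(χ, K, 1)` continuous bounded with `φ ∘ ι_∞ = φ(1)`, and a basis of `V(χʷ, K, 1)` by continuous bounded functions
    {χ : HeckeCharacter L} {K' : Subgroup (quasiSplit (↥(maximalRealSubfield L)) L (IsCMField.complexConj L) 3).Adelic} {ω : ↥K' → ℂ} {φ : (quasiSplit (↥(maximalRealSubfield L)) L (IsCMField.complexConj L) 3).Adelic → ℂ} (hφV : φ ∈ chiSectionSpace χ K' ω) (hφc : Continuous φ) {Mφ : ℝ} (hφM : ∀ x, ‖φ x‖ ≤ Mφ)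
    -- the LEVEL: `K′ ≤ K`, `ι(K_∞) ⊆ K′`, an open compact `U₀` with `ι_f(U₀ ∩ G_f) ⊆ K′` on which `ω = 1`, continuity of the sections; auxiliary Haar measures on `G_∞` (two-sided) and `G(𝔸_f)`
    (hK' : K' ≤ ((standardMaximalCompactGL 3 L).comap (adelicVal (↥(maximalRealSubfield L)) L (IsCMField.complexConj L) 3 ((StdForm.antidiagonal 3).over L)) : Subgroup (quasiSplit (↥(maximalRealSubfield L)) L (IsCMField.complexConj L) 3).Adelic))
    (hKinf : ∀ k : arch (↥(maximalRealSubfield L)) L (IsCMField.complexConj L) 3 ((StdForm.antidiagonal 3).over L), adelicVal (↥(maximalRealSubfield L)) L (IsCMField.complexConj L) 3 ((StdForm.antidiagonal 3).over L) (archToAdelic (↥(maximalRealSubfield L)) L (IsCMField.complexConj L) 3 _ k) ∈ standardMaximalCompactGL 3 L →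
      archToAdelic (↥(maximalRealSubfield L)) L (IsCMField.complexConj L) 3 _ k ∈ K')
    (U₀ : Subgroup (GL (Fin 3) (FiniteAdeleRing (𝓞 L) L))) (hU₀o : IsOpen (U₀ : Set (GL (Fin 3) (FiniteAdeleRing (𝓞 L) L)))) (hU₀c : IsCompact (U₀ : Set (GL (Fin 3) (FiniteAdeleRing (𝓞 L) L))))
    (hU : ∀ b : finAdelic (↥(maximalRealSubfield L)) L (IsCMField.complexConj L) 3 ((StdForm.antidiagonal 3).over L), (b : GL (Fin 3) (FiniteAdeleRing (𝓞 L) L)) ∈ U₀ →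
      ∃ hb : finAdelicToAdelic (↥(maximalRealSubfield L)) L (IsCMField.complexConj L) 3 ((StdForm.antidiagonal 3).over L) b ∈ K', ω ⟨_, hb⟩ = 1)
    (hVc : ∀ φ ∈ chiSectionSpace χ K' ω, Continuous φ)
    (μa : Measure (arch (↥(maximalRealSubfield L)) L (IsCMField.complexConj L) 3 ((StdForm.antidiagonal 3).over L))) [μa.IsHaarMeasure] [μa.IsMulRightInvariant]
    (μf : Measure (finAdelic (↥(maximalRealSubfield L)) L (IsCMField.complexConj L) 3 ((StdForm.antidiagonal 3).over L))) [μf.IsHaarMeasure]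
    {ι' : Type} [Fintype ι'] [DecidableEq ι'] (bV : Module.Basis ι' ℂ ↥(chiSectionSpace (reflectChar (IsCMField.complexConj L) χ) K' ω))
    (hbc : ∀ j, Continuous ((bV j : ↥(chiSectionSpace (reflectChar (IsCMField.complexConj L) χ) K' ω)) : (quasiSplit (↥(maximalRealSubfield L)) L (IsCMField.complexConj L) 3).Adelic → ℂ)) {Mb : ℝ} (hbM : ∀ j x, ‖((bV j : ↥(chiSectionSpace (reflectChar (IsCMField.complexConj L) χ) K' ω)) : (quasiSplit (↥(maximalRealSubfield L)) L (IsCMField.complexConj L) 3).Adelic → ℂ) x‖ ≤ Mb)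
    (h2 : Module.finrank (↥(maximalRealSubfield L)) L = 2) (hc : IsCMField.complexConj L ≠ 1) (hJ : ((StdForm.antidiagonal 3).over L).det ≠ 0)
    (ψ : ↥(TorusDict.torus (IsCMField.complexConj L)) →ₜ* ℂˣ) (hψ : TorusDict.IsAutomorphic (IsCMField.complexConj L) ψ)
    -- THE THREE REMAINING LETTERS about the untwisted named family
    (hE6 : ∀ T : ℝ≥0, 1 ≤ T → ∃ Fam : ℂ → (quasiSplit (↥(maximalRealSubfield L)) L (IsCMField.complexConj L) 3).L2 μ,
      ∀ z : ℂ, z ∉ midWitnessP L μ νG ν h𝓕N h𝓕c h𝓕₀ hβ hμZ hφV hφc hφM hK' hKinf U₀ hU₀o hU₀c hU hVc μa μf bV hbc hbM h2 hc hJ ψ hψ → ((Fam z : (quasiSplit (↥(maximalRealSubfield L)) L (IsCMField.complexConj L) 3).L2 μ) : (quasiSplit (↥(maximalRealSubfield L)) L (IsCMField.complexConj L) 3).automorphicQuotient → ℂ) =ᵐ[μ] (quasiSplit (↥(maximalRealSubfield L)) L (IsCMField.complexConj L) 3).quotFun (truncation ν 𝓕 T (midWitnessEc L μ νG ν h𝓕N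 h𝓕c h𝓕₀ hβ hμZ hφV hφc hφM hK' hKinf U₀ hU₀o hU₀c hU hVc μa μf bV hbc hbM h2 hc hJ ψ hψ z)))
    (hMSP' : ∀ z₀ ∈ midWitnessP L μ νG ν h𝓕N h𝓕c h𝓕₀ hβ hμZ hφV hφc hφM hK' hKinf U₀ hU₀o hU₀c hU hVc μa μf bV hbc hbM h2 hc hJ ψ hψ, 1 < z₀.re → z₀ ≠ (3 : ℂ) / 2 → ∀ T : ℝ≥0, 1 ≤ T →
      ∃ Fam : ℂ → (quasiSplit (↥(maximalRealSubfield L)) L (IsCMField.complexConj L) 3).L2 μ,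
        (∀ z : ℂ, z ∉ midWitnessP L μ νG ν h𝓕N h𝓕c h𝓕₀ hβ hμZ hφV hφc hφM hK' hKinf U₀ hU₀o hU₀c hU hVc μa μf bV hbc hbM h2 hc hJ ψ hψ → ((Fam z : (quasiSplit (↥(maximalRealSubfield L)) L (IsCMField.complexConj L) 3).L2 μ) : (quasiSplit (↥(maximalRealSubfield L)) L (IsCMField.complexConj L) 3).automorphicQuotient → ℂ) =ᵐ[μ] (quasiSplit (↥(maximalRealSubfield L)) L (IsCMField.complexConj L) 3).quotFun (truncation ν 𝓕 T (midWitnessEc L μ νG ν h𝓕N h𝓕c h𝓕₀ hβ hμZ hφV hφc hφM hK' hKinf U₀ hU₀o hU₀c hU hVc μa μf bV hbc hbM h2 hc hJ ψ hψ z))) ∧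
        ∃ C : ℝ, ∀ᶠ z in 𝓝[≠] z₀, ‖Fam z‖ ≤ C)
    (hMS32 : ∀ T : ℝ≥0, 1 ≤ T →
      ∃ C : ℝ, ∀ᶠ z in 𝓝[≠] ((3 : ℂ) / 2), ‖z - (3 : ℂ) / 2‖ * (eLpNorm ((quasiSplit (↥(maximalRealSubfield L)) L (IsCMField.complexConj L) 3).quotFun (truncation ν 𝓕 T (midWitnessEc L μ νG ν h𝓕N h𝓕c h𝓕₀ hβ hμZ hφV hφc hφM hK' hKinf U₀ hU₀o hU₀c hU hVc μa μf bV hbc hbM h2 hc hJ ψ hψ z))) 2 μ).toReal ≤ C) :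
    (∀ z₀ ∈ midWitnessP L μ νG ν h𝓕N h𝓕c h𝓕₀ hβ hμZ hφV hφc hφM hK' hKinf U₀ hU₀o hU₀c hU hVc μa μf bV hbc hbM h2 hc hJ ψ hψ, 1 < z₀.re → z₀ ≠ (3 : ℂ) / 2 → ∀ K : Set (quasiSplit (↥(maximalRealSubfield L)) L (IsCMField.complexConj L) 3).Adelic, IsCompact K →
      ∃ C : ℝ, ∀ᶠ z in 𝓝[≠] z₀, ∀ g ∈ K, ‖midWitnessEc L μ νG ν h𝓕N h𝓕c h𝓕₀ hβ hμZ hφV hφc hφM hK' hKinf U₀ hU₀o hU₀c hU hVc μa μf bV hbc hbM h2 hc hJ ψ hψ z g * ((detChar (↥(maximalRealSubfield L)) L (IsCMField.complexConj L) h2 hc 3 ((StdForm.antidiagonal 3).over L) ψ hψ hJ g : ℂˣ) : ℂ)‖ ≤ C) ∧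
    (∀ g, ∃ C : ℝ, ∀ᶠ z in 𝓝[≠] ((3 : ℂ) / 2), ‖(z - (3 : ℂ) / 2) * (midWitnessEc L μ νG ν h𝓕N h𝓕c h𝓕₀ hβ hμZ hφV hφc hφM hK' hKinf U₀ hU₀o hU₀c hU hVc μa μf bV hbc hbM h2 hc hJ ψ hψ z g * ((detChar (↥(maximalRealSubfield L)) L (IsCMField.complexConj L) h2 hc 3 ((StdForm.antidiagonal 3).over L) ψ hψ hJ g : ℂˣ) : ℂ))‖ ≤ C) := by
  obtain ⟨-, -, -, -, -, -, -, hPcd, -⟩ := midWitnessExports_spec L μ νG ν h𝓕N h𝓕c h𝓕₀ hβ hμZ hφV hφc hφM hK' hKinf U₀ hU₀o hU₀c hU hVc μa μf bV hbc hbM h2 hc hJ ψ hψ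
  have hEcinv := hEcinv_midWitness L μ νG ν h𝓕N h𝓕c h𝓕₀ hβ hμZ hφV hφc hφM hK' hKinf U₀ hU₀o hU₀c hU hVc μa μf bV hbc hbM h2 hc hJ ψ hψ
  have hL2 : ∀ z : ℂ, z ∉ midWitnessP L μ νG ν h𝓕N h𝓕c h𝓕₀ hβ hμZ hφV hφc hφM hK' hKinf U₀ hU₀o hU₀c hU hVc μa μf bV hbc hbM h2 hc hJ ψ hψ → ∀ T : ℝ≥0, 1 ≤ T →
      MemLp ((quasiSplit (↥(maximalRealSubfield L)) L (IsCMField.complexConj L) 3).quotFun (truncation ν 𝓕 T (midWitnessEc L μ νG ν h𝓕N h𝓕c h𝓕₀ hβ hμZ hφV hφc hφM hK' hKinf U₀ hU₀o hU₀c hU hVc μa μf bV hbc hbM h2 hc hJ ψ hψ z))) 2 μ := fun z hz T hT => by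
    obtain ⟨Fam₀, hFam₀⟩ := hE6 T hT
    exact (Lp.memLp (Fam₀ z)).ae_eq (hFam₀ z hz)
  have hPK := hbddPK_of_L2Family_letters_cm_three L μ νG ν h𝓕N (midWitnessEc L μ νG ν h𝓕N h𝓕c h𝓕₀ hβ hμZ hφV hφc hφM hK' hKinf U₀ hU₀o hU₀c hU hVc μa μf bV hbc hbM h2 hc hJ ψ hψ) (midWitnessP L μ νG ν h𝓕N h𝓕c h𝓕₀ hβ hμZ hφV hφc hφM hK' hKinf U₀ hU₀o hU₀c hU hVc μa μf bV hbc hbM h2 hc hJ ψ hψ) hPcd hEcinv (fun z₀ _ _ => hSM_midWitness L μ νG ν h𝓕N h𝓕c h𝓕₀ hβ hμZ hφV hφc hφM hK' hKinf U₀ hU₀o hU₀c hU hVc μa μf bV hbc hbM h2 hc hJ ψ hψ z₀) hE6 hMSP'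
  have h32 := hbdd32_of_letters_cm_three L μ νG ν h𝓕N (midWitnessEc L μ νG ν h𝓕N h𝓕c h𝓕₀ hβ hμZ hφV hφc hφM hK' hKinf U₀ hU₀o hU₀c hU hVc μa μf bV hbc hbM h2 hc hJ ψ hψ) (midWitnessP L μ νG ν h𝓕N h𝓕c h𝓕₀ hβ hμZ hφV hφc hφM hK' hKinf U₀ hU₀o hU₀c hU hVc μa μf bV hbc hbM h2 hc hJ ψ hψ) hPcd hEcinv (hSM_midWitness L μ νG ν h𝓕N h𝓕c h𝓕₀ hβ hμZ hφV hφc hφM hK' hKinf U₀ hU₀o hU₀c hU hVc μa μf bV hbc hbM h2 hc hJ ψ hψ ((3 : ℂ) / 2)) hL2 hMS32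
  refine ⟨fun z₀ hz₀ h1 h32' K hK => ?_, fun g => ?_⟩
  · obtain ⟨C, hC⟩ := hPK z₀ hz₀ h1 h32' K hK
    refine ⟨C, hC.mono fun z hz g hg => ?_⟩
    rw [norm_mul, (detChar (↥(maximalRealSubfield L)) L (IsCMField.complexConj L) h2 hc 3 ((StdForm.antidiagonal 3).over L) ψ hψ hJ).norm_coe, mul_one]
    exact hz g hg
  · obtain ⟨C, hC⟩ := h32 g
    refine ⟨C, hC.mono fun z hz => ?_⟩
    rw [← mul_assoc, norm_mul, (detChar (↥(maximalRealSubfield L)) L (IsCMField.complexConj L) h2 hc 3 ((StdForm.antidiagonal 3).over L) ψ hψ hJ).norm_coe, mul_one]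
    exact hz

end Summit.HodgeConjecture.HodgeConjecture.Cruxes.H413.K2E1ChiEisensteinLedgerLettersOfExportsCMThree

end
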